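import Summits.ResolutionOfSingularities.ResolutionOfSingularities.Theorems.FrobeniusLadderFInjectiveMacaulayficationFiniteStableBlowupAffine
import Mathlib.AlgebraicGeometry.FunctionField
import HarnessLib

/-!
# A finite (or just affine) morphism inverting a stable ideal sheaf is the blowing up along it
# (S-V2 of the FC′ r2 rung, global part; crux `FInjectiveMacaulayfication` stmt-ResolutionOfSingularities-15315, chain w45a)

[OURS · L1 W4.5a · res-D-pv-019 AS res-L1-w45a-stub-7] Support file (`--supports stmt-ResolutionOfSingularities-15315
--as helper`) for the crux `FrobeniusLadder.FInjectiveMacaulayfication`; NOT a statement of any manuscript; no definitions,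
no named facts; AI-written (AI review is weaker than expert review). With `…FiniteStableBlowupAffine.lean` it discharges,
in generic form, the typed input S-V2 `FiniteModificationOfBlowup.IsBlowupOfFiniteOfStable` of res-L1-w45a-strat-1's
`FCRungsSig.lean` v2.4 §B8 (the verbatim wrapper imports this file and `…FiniteModificationOfBlowup`).

PROVED (over `isBlowup_SpecMap_of_stable` and the tree's `IsBlowup.of_openCover`, `IsBlowup.iso_comp`/`comp_iso`,
`comap_fromSpec`, Mathlib's `toSpecΓ_SpecMap_appLE`, `SpecMap_appLE_fromSpec`): **a morphism `g : X₃ → X₂` which is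
affine-locally `Spec B → Spec A` with `A → B` injective is THE blowing up of `X₂` along any ideal sheaf `𝔠 ⊆ 𝒪_{X₂}`
that is `g_*𝒪_{X₃}`-stable (`𝔠(U)·Γ(X₃, g⁻¹U) ⊆ g^*𝔠(U)` on affine opens `U`) and becomes an effective Cartier
divisor on `X₃`** (blow-up = universal property, Görtz–Wedhorn I, Def. 13.90). Typical instances: the normalisation, or
a finite birational partial normalisation, of an integral scheme together with a conductor-type ideal it inverts;
`Spec A[I/x] → Spec A` when `I·A[I/x] = I`.

* `app_injective_of_stalkMap_injective`, `app_injective_of_eq_bot`, `app_injective_of_isIso_stalkMap_off_support` —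
  injectivity of `g^*` on sections over an integral base;
* `isBlowup_morphismRestrict_of_stable`, **`isBlowup_of_stable`** — globalisation over an affine cover of `X₂`;
* **`isBlowup_of_finite_of_stable`** — the shape of the typed S-V2: `g` finite surjective onto an integral scheme, a stalk
  isomorphism off the support of `𝔠 ≠ 0`, `𝔠` stable, `𝔠𝒪_{X₃}` effective Cartier ⇒ `IsBlowup g 𝔠` (integrality of
  the base and the stalk-isomorphism clause serve only to make `g^*` injective).

Sources: U. Görtz, T. Wedhorn, *Algebraic Geometry I* (2nd ed. 2020), Def. 13.90, Prop. 13.91, Prop. 13.92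
[GortzWedhorn2020]; The Stacks Project, Tag 0806 [StacksProject].
-/

-- single-problem summit: the doubled namespace component is forced
set_option linter.dupNamespace false

noncomputable section

open CategoryTheory CategoryTheory.Limits AlgebraicGeometry TopologicalSpace
open Literature.AlgebraicGeometry.Resolution

namespace Summit.ResolutionOfSingularities.ResolutionOfSingularities.Theorems.FInjectiveMacaulayfication.FiniteStableBlowup

universe u

/-! ## Globalisation over the base -/

section Global

variable {X₂ X₃ : Scheme.{u}} (g : X₃ ⟶ X₂) (𝔠 : X₂.IdealSheafData)

/-- **Sections are detected by one injective stalk map** on an integral scheme: if some point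
`x₃` over the open `U ⊆ X₂` has an injective stalk map `𝒪_{X₂, g x₃} → 𝒪_{X₃, x₃}`, then
`g^* : Γ(X₂, U) → Γ(X₃, g⁻¹U)` is injective (germs of an integral scheme are injective).
[folklore] -/
theorem app_injective_of_stalkMap_injective [IsIntegral X₂] (U : X₂.Opens) (x₃ : X₃)
    (hx : g.base x₃ ∈ U) (hst : Function.Injective (g.stalkMap x₃)) :
    Function.Injective (g.app U).hom := by
  intro a b hab
  apply germ_injective_of_isIntegral X₂ (g.base x₃) hx
  apply hst
  rw [Scheme.Hom.germ_stalkMap_apply, Scheme.Hom.germ_stalkMap_apply]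
  exact congrArg _ hab

/-- Sections over an open without points form the zero ring, so every map out of them is
injective. [folklore] -/
theorem app_injective_of_eq_bot {U : X₂.Opens} (hU : U = ⊥) :
    Function.Injective (g.app U).hom := by
  haveI : Subsingleton Γ(X₂, U) :=
    CommRingCat.subsingleton_of_isTerminal (X₂.sheaf.isTerminalOfEqEmpty hU)
  exact Function.injective_of_subsingleton _

/-- **Injectivity of `g^*` on sections** for `g : X₃ → X₂` surjective onto an integral scheme
which is a stalk isomorphism off the support of a non-zero ideal sheaf `𝔠`: every non-empty open
meets the complement of `supp 𝔠`, over which some stalk map is an isomorphism. [folklore] -/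
theorem app_injective_of_isIso_stalkMap_off_support [IsIntegral X₂]
    (hsurj : Function.Surjective g.base) (h𝔠 : 𝔠 ≠ ⊥)
    (hiso : ∀ x₃ : X₃, g.base x₃ ∉ (𝔠.support : Set X₂) → IsIso (g.stalkMap x₃))
    (U : X₂.Opens) : Function.Injective (g.app U).hom := by
  by_cases hne : (U : Set X₂).Nonempty
  · -- a point of `U` off the support
    have hsupp : ((𝔠.support : Set X₂)ᶜ).Nonempty := by
      rw [Set.nonempty_compl]
      intro h
      apply h𝔠
      rw [← Scheme.IdealSheafData.support_eq_top_iff]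
      exact SetLike.coe_injective (by simpa using h)
    obtain ⟨x₂, hx₂U, hx₂⟩ :=
      nonempty_preirreducible_inter U.2 𝔠.support.isClosed.isOpen_compl hne hsupp
    obtain ⟨x₃, rfl⟩ := hsurj x₂
    haveI := hiso x₃ hx₂
    exact app_injective_of_stalkMap_injective g U x₃ hx₂U
      (ConcreteCategory.bijective_of_isIso (g.stalkMap x₃)).1
  · apply app_injective_of_eq_bot
    ext x
    simp only [Opens.coe_bot, Set.mem_empty_iff_false, iff_false]
    exact fun hx => hne ⟨x, hx⟩

variable [IsAffineHom g]

/-- **Over an affine open `U` of the base, `g|_U : g⁻¹U → U` is a blowing up of `U` along `𝔠|_U`**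
as soon as `g^* : Γ(X₂, U) → Γ(X₃, g⁻¹U)` is injective, `𝔠(U)` is stable under `Γ(X₃, g⁻¹U)`
and `𝔠 · 𝒪_{X₃}` is an effective Cartier divisor (`isBlowup_SpecMap_of_stable` moved along
`U ≅ Spec Γ(X₂, U)`, `g⁻¹U ≅ Spec Γ(X₃, g⁻¹U)`). [folklore] -/
theorem isBlowup_morphismRestrict_of_stable (U : X₂.Opens) (hU : IsAffineOpen U)
    (hinj : Function.Injective (g.app U).hom)
    (hstab : ∀ b : Γ(X₃, g ⁻¹ᵁ U), b ∈ (𝔠.ideal ⟨U, hU⟩).map (g.app U).hom →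
      ∃ a ∈ 𝔠.ideal ⟨U, hU⟩, (g.app U).hom a = b)
    (hcart : IsEffectiveCartier (𝔠.comap g)) :
    IsBlowup (g ∣_ U) (𝔠.comap U.ι) := by
  have hV : IsAffineOpen (g ⁻¹ᵁ U) := hU.preimage g
  -- `Spec Γ(X₃, g⁻¹U) → Spec Γ(X₂, U)` is a blowing up along `Ĩ(𝔠(U))`
  have hsq : hV.fromSpec ≫ g = Spec.map (g.app U) ≫ hU.fromSpec := by
    rw [Scheme.Hom.app_eq_appLE, IsAffineOpen.SpecMap_appLE_fromSpec g hU hV le_rfl]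
  have hcart' : IsEffectiveCartier
      ((affineBlowup.idealSheaf (𝔠.ideal ⟨U, hU⟩)).comap (Spec.map (g.app U))) := by
    have h1 := hcart.comap_of_isOpenImmersion hV.fromSpec
    rw [← Scheme.IdealSheafData.comap_comp, hsq, Scheme.IdealSheafData.comap_comp,
      comap_fromSpec 𝔠 ⟨U, hU⟩] at h1
    exact h1
  have h0 : IsBlowup (Spec.map (g.app U)) (affineBlowup.idealSheaf (𝔠.ideal ⟨U, hU⟩)) := by
    have := isBlowup_SpecMap_of_stable (g.app U).hom (𝔠.ideal ⟨U, hU⟩) hinj hstab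
      (by simpa only [CommRingCat.ofHom_hom] using hcart')
    simpa only [CommRingCat.ofHom_hom] using this
  -- transport along `U ≅ Spec Γ(X₂, U)` and `g⁻¹U ≅ Spec Γ(X₃, g⁻¹U)`
  have h1 := (h0.iso_comp hV.isoSpec).comp_iso hU.isoSpec.symm
  have e2 : (hV.isoSpec.hom ≫ Spec.map (g.app U)) ≫ hU.isoSpec.symm.hom = g ∣_ U := by
    rw [Iso.symm_hom, IsAffineOpen.isoSpec_hom, Category.assoc, Scheme.Hom.app_eq_appLE,
      Scheme.Opens.toSpecΓ_SpecMap_appLE_assoc, Scheme.Hom.resLE_eq_morphismRestrict,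
      ← hU.isoSpec_hom, Iso.hom_inv_id, Category.comp_id]
  have e3 : (affineBlowup.idealSheaf (𝔠.ideal ⟨U, hU⟩)).comap hU.isoSpec.symm.inv =
      𝔠.comap U.ι := by
    rw [Iso.symm_inv, ← comap_fromSpec 𝔠 ⟨U, hU⟩, ← Scheme.IdealSheafData.comap_comp,
      IsAffineOpen.isoSpec_hom_fromSpec]
  rw [e2, e3] at h1
  exact h1

/-- **A morphism which is affine-locally `Spec` of a stable extension inverting `𝔠` is the
blowing up along `𝔠`.** For an affine morphism `g : X₃ → X₂` and an ideal sheaf `𝔠` on `X₂`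
such that, over every affine open `U`, `g^*` is injective and `𝔠(U) · Γ(X₃, g⁻¹U) ⊆ g^*(𝔠(U))`
(stability), and such that `𝔠 · 𝒪_{X₃}` is an effective Cartier divisor, `g` is a blowing up of
`X₂` along `𝔠` (`IsBlowup`, universal property): affine-locally on `X₂` by
`isBlowup_morphismRestrict_of_stable`, glued by `IsBlowup.of_openCover`. Typical instances: the
normalisation or any finite birational partial normalisation `X₃ → X₂` and a conductor-type
ideal `𝔠` (an ideal of `𝒪_{X₂}` that is already a `g_*𝒪_{X₃}`-ideal) which becomes invertible
on `X₃`. [folklore; cite: GortzWedhorn2020, Def. 13.90, Prop. 13.92; StacksProject, Tag 0806] -/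
theorem isBlowup_of_stable (hinj : ∀ U : X₂.affineOpens, Function.Injective (g.app U).hom)
    (hcart : IsEffectiveCartier (𝔠.comap g))
    (hstab : ∀ (U : X₂.affineOpens) (b : Γ(X₃, g ⁻¹ᵁ (U : X₂.Opens))),
      b ∈ (𝔠.ideal U).map (g.app U).hom → ∃ a ∈ 𝔠.ideal U, (g.app U).hom a = b) :
    IsBlowup g 𝔠 :=
  IsBlowup.of_openCover X₂.affineCover fun i =>
    isBlowup_morphismRestrict_of_stable g 𝔠 _ (isAffineOpen_opensRange (X₂.affineCover.f i))
      (hinj ⟨_, isAffineOpen_opensRange _⟩) (hstab ⟨_, isAffineOpen_opensRange _⟩) hcart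

omit [IsAffineHom g] in
/-- **A finite morphism onto an integral scheme, stalk-isomorphic off the support of a non-zero
stable ideal sheaf `𝔠` which it inverts, is the blowing up along `𝔠`** — the shape of the typed
input S-V2 `IsBlowupOfFiniteOfStable` of the `FInjectiveMacaulayfication` r2 rung (all its
hypotheses, some of them redundant: integrality of `X₃` and the stalk-isomorphism clause serve
only to make `g^*` injective). [folklore] -/
theorem isBlowup_of_finite_of_stable [IsIntegral X₂] [IsFinite g]
    (hsurj : Function.Surjective g.base) (h𝔠 : 𝔠 ≠ ⊥)
    (hiso : ∀ x₃ : X₃, g.base x₃ ∉ (𝔠.support : Set X₂) → IsIso (g.stalkMap x₃))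
    (hcart : IsEffectiveCartier (𝔠.comap g))
    (hstab : ∀ (U : X₂.affineOpens) (b : Γ(X₃, g ⁻¹ᵁ (U : X₂.Opens))),
      b ∈ (𝔠.ideal U).map (g.app U).hom → ∃ a ∈ 𝔠.ideal U, (g.app U).hom a = b) :
    IsBlowup g 𝔠 :=
  isBlowup_of_stable g 𝔠
    (fun U => app_injective_of_isIso_stalkMap_off_support g 𝔠 hsurj h𝔠 hiso U) hcart hstab

end Global

end Summit.ResolutionOfSingularities.ResolutionOfSingularities.Theorems.FInjectiveMacaulayfication.FiniteStableBlowup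

end
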